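import Literature.AlgebraicGeometry.Motives.HodgeLieOfAbelianVarietyPower
import Literature.AlgebraicGeometry.Motives.HodgeLieIsomorphismInvariance
import HarnessLib

/-!
# `Lie Hg(H¹X) ≅ Lie Hg(H¹X')` for isogenous complex abelian varieties, and `Lie Hg(H¹(Bⁿ)) ≅ Lie Hg(H¹B)`, as LIE ALGEBRAS

Family `hodge`, layer `Literature/AlgebraicGeometry/Motives`; THEOREMS ONLY (no definition, no named fact).  Written for
the cell `pub-hodgecm2` (COR-CM), seat `b27` gen 43 (count-neutral Mumford–Tate-rank ladder).  Sequel of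
`Motives/HodgeLieOfAbelianVarietyBiproduct` (gen 35) and `Motives/HodgeLieOfAbelianVarietyPower` (gen 42), which compared
the Lie algebras of the Hodge groups of `H¹` of isogenous varieties and of powers only through their DIMENSIONS
(`dim Lie Hg(H¹X) = dim Lie Hg(H¹X')`, `dim Lie Hg(H¹(⨁ B)) = dim Lie Hg(H¹B)`).  With the Lie-algebra isomorphisms of
`Motives/HodgeLieIsomorphismInvariance` (conjugation along an isomorphism of Hodge structures; the diagonal
`𝔥(H) ≅ 𝔥(H^{⊕ι})`), transported along `H¹(X') = (g^*)^* H¹(X)` for an isogeny `g` (`hodge_one_eq_comapEquiv_of_isIsogeny`)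
and along Künneth in degree one (`pi_hodge_one_eq_comapEquiv_biproduct`), we get ISOMORPHISMS OF LIE ALGEBRAS over `ℚ`:

* **`exists_lieEquiv_hodgeLie_hodge_one_of_isIsogeny`** — for an isogeny `g : X ⟶ X'`, `Y ↦ g^* Y (g^*)⁻¹` is an
  isomorphism `Lie Hg(H¹X') ≃ₗ⁅ℚ⁆ Lie Hg(H¹X)` (`Φ(Y) ∘ g^* = g^* ∘ Y`); `nonempty_lieEquiv_hodgeLie_hodge_one_of_isIsogenous`;
* **`nonempty_lieEquiv_hodgeLie_hodge_one_biproduct_const`** — `Lie Hg(H¹B) ≃ₗ⁅ℚ⁆ Lie Hg(H¹(⨁_{Fin (a+1)} B))`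
  (Moonen–Zarhin 1999 §1: «for `n ≥ 1` we can identify `Hg(Xⁿ)` with `Hg(X)` acting diagonally on `V_{Xⁿ} = (V_X)ⁿ`»);
* **`nonempty_lieEquiv_hodgeLie_hodge_one_of_isIsogenous_biproduct_const`** — `Lie Hg(H¹X) ≃ₗ⁅ℚ⁆ Lie Hg(H¹B)` for every
  `X ∼ ⨁_{Fin (a+1)} B`;
and hence the invariance of SIMPLICITY of `Lie Hg(H¹·)` (the tree's idiom «every Lie subalgebra of `𝔤𝔩(H¹)` with carrier
`Lie Hg` is simple», as in `CorCM/MumfordTateRankSevenSemisimple`) under isogeny and under passing to / from a power: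
`isSimple_hodgeLie_hodge_one_iff_of_isIsogenous`, `isSimple_hodgeLie_hodge_one_iff_of_isIsogenous_biproduct_const`.

Lie subalgebras of `End_ℚ` carry the commutator bracket `LieRing.ofAssociativeRing` (supplied by `letI`, as in
`Motives/HodgeLieDerivedSemisimple`).

## References
* [MoonenZarhin1999LowDim] B. Moonen, Yu. Zarhin, *Hodge classes on abelian varieties of low dimension*, Math. Ann. 315
  (1999), §1 [corpus: paper:arxiv-math_9901113 p. 2]. [cite: MoonenZarhin1999LowDim, §1]
* [Moonen1999MTNotes] B. Moonen, *Notes on Mumford–Tate groups* (1999), (1.7)–(1.8). [cite: Moonen1999MTNotes, (1.7) and (1.8)]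
* [Deligne1982HodgeCycles] P. Deligne, *Hodge cycles on abelian varieties*, LNM 900 (1982), I §3.1 and Prop. 3.4.
  [cite: Deligne1982HodgeCycles, I §3.1 and Prop. 3.4]
* [VoisinHodgeI2002] C. Voisin, *Hodge Theory and Complex Algebraic Geometry I*, §7.3.2 and Thm. 11.40 (Künneth).
  [cite: VoisinHodgeI2002, §7.3.2]
-/

noncomputable section

open CategoryTheory CategoryTheory.Limits

namespace Literature.AlgebraicGeometry.Motives

namespace AbelianVariety

open Literature.AlgebraicGeometry.HodgeTheory
open Literature.AlgebraicGeometry.Motives.HodgeStructure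
open Literature.AlgebraicGeometry.Pohlmann1968 (hodge_one_eq_comapEquiv_of_isIsogeny)
open Literature.AlgebraicGeometry.ComplexMultiplication (isogeny_bettiMap_bijective_holds)

/-- Simplicity is invariant under isomorphisms of Lie algebras.  Private copy of the tree's
`Literature.Algebra.Lie.SimpleBaseChange.isSimple_of_lieEquiv`, to keep this file's imports inside `Motives/`.
[cite: Moonen1999MTNotes, (1.7) and (1.8)] -/
private theorem isSimple_of_lieEquiv' {R L L' : Type*} [CommRing R] [LieRing L] [LieAlgebra R L] [LieRing L']
    [LieAlgebra R L'] (e : L ≃ₗ⁅R⁆ L') [LieAlgebra.IsSimple R L'] : LieAlgebra.IsSimple R L := by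
  -- adapted from Literature/Algebra/Lie/SimpleBaseChange.lean (`isSimple_of_lieEquiv`)
  refine ⟨fun I => ?_, fun hab => ?_⟩
  · rcases LieAlgebra.IsSimple.eq_bot_or_eq_top (LieIdeal.comap (e.symm : L' →ₗ⁅R⁆ L) I) with h | h
    · left
      rw [eq_bot_iff]
      intro x hx
      have hx' : e x ∈ LieIdeal.comap (e.symm : L' →ₗ⁅R⁆ L) I := by
        rw [LieIdeal.mem_comap]
        change e.symm (e x) ∈ I
        rw [e.symm_apply_apply]; exact hx
      rw [h, LieSubmodule.mem_bot] at hx'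
      rw [LieSubmodule.mem_bot, ← e.symm_apply_apply x, hx', map_zero]
    · right
      rw [eq_top_iff]
      intro x _
      have hx' : e x ∈ LieIdeal.comap (e.symm : L' →ₗ⁅R⁆ L) I := by rw [h]; exact LieSubmodule.mem_top _
      rw [LieIdeal.mem_comap] at hx'
      change e.symm (e x) ∈ I at hx'
      rw [e.symm_apply_apply] at hx'
      exact hx'
  · haveI := hab
    refine LieAlgebra.IsSimple.non_abelian R (L := L') ⟨fun x y => ?_⟩
    rw [← e.apply_symm_apply x, ← e.apply_symm_apply y, ← e.map_lie, trivial_lie_zero, map_zero]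

variable [HodgeTensorFacts.{0, 0}]

/-! ### §1 Isogenies -/

section Isogeny

variable {X X' : AbelianVariety ℂ} {n m : ℕ} (hX : IsSmoothProjective n X.X) (hX' : IsSmoothProjective m X'.X)

/-- **`Lie Hg(H¹X') ≅ Lie Hg(H¹X)` as Lie algebras over `ℚ`, for an isogeny `g : X ⟶ X'`**, by `Y ↦ g^* ∘ Y ∘ (g^*)⁻¹`
(characterised by `Φ(Y) ∘ g^* = g^* ∘ Y`): `H¹(X') = (g^*)^* H¹(X)` as Hodge structures (`hodge_one_eq_comapEquiv_of_isIsogeny`)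
and conjugation along an isomorphism of Hodge structures is an isomorphism of Hodge Lie algebras
(`HodgeStructure.exists_lieEquiv_of_eq_hodgeLie_comapEquiv`). [cite: Moonen1999MTNotes, (1.7) and (1.8)]
[cite: VoisinHodgeI2002, §7.3.2] [cite: Deligne1982HodgeCycles, I §3.1 and Prop. 3.4] -/
theorem exists_lieEquiv_hodgeLie_hodge_one_of_isIsogeny {g : X ⟶ X'} (hg : IsIsogeny g) :
    haveI := BettiUniverse.finite hX 1
    haveI := BettiUniverse.finite hX' 1
    letI : LieRing (Module.End ℚ (bettiCohomology X.X 1)) := LieRing.ofAssociativeRing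
    letI : LieRing (Module.End ℚ (bettiCohomology X'.X 1)) := LieRing.ofAssociativeRing
    ∀ (𝔏' : LieSubalgebra ℚ (Module.End ℚ (bettiCohomology X'.X 1)))
      (𝔏 : LieSubalgebra ℚ (Module.End ℚ (bettiCohomology X.X 1))),
      𝔏'.toSubmodule = (BettiUniverse.hodge exists_isReal_hodgeModel_holds hX' 1).hodgeLie →
      𝔏.toSubmodule = (BettiUniverse.hodge exists_isReal_hodgeModel_holds hX 1).hodgeLie →
      ∃ Φ : 𝔏' ≃ₗ⁅ℚ⁆ 𝔏, ∀ Y : 𝔏',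
        ((Φ Y : 𝔏) : Module.End ℚ (bettiCohomology X.X 1)) ∘ₗ BettiUniverse.pull g.hom.hom.hom 1 =
          BettiUniverse.pull g.hom.hom.hom 1 ∘ₗ (Y : Module.End ℚ (bettiCohomology X'.X 1)) := by
  haveI := BettiUniverse.finite hX 1
  haveI := BettiUniverse.finite hX' 1
  letI : LieRing (Module.End ℚ (bettiCohomology X.X 1)) := LieRing.ofAssociativeRing
  letI : LieRing (Module.End ℚ (bettiCohomology X'.X 1)) := LieRing.ofAssociativeRing
  intro 𝔏' 𝔏 h𝔏' h𝔏
  rw [hodge_one_eq_comapEquiv_of_isIsogeny hX hX' hg] at h𝔏'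
  obtain ⟨Φ, hΦ⟩ := exists_lieEquiv_of_eq_hodgeLie_comapEquiv _ _ 𝔏' 𝔏 h𝔏' h𝔏
  refine ⟨Φ, fun Y => ?_⟩
  rw [hΦ, LinearMap.comp_assoc, LinearMap.comp_assoc]
  congr 1
  refine LinearMap.ext fun v => ?_
  simp only [LinearMap.coe_comp, LinearEquiv.coe_coe, Function.comp_apply]
  congr 1
  exact (LinearEquiv.ofBijective _ (isogeny_bettiMap_bijective_holds X X' g hg)).symm_apply_apply v

/-- **Isogenous complex abelian varieties have isomorphic Hodge Lie algebras** (on `H¹`, as Lie algebras over `ℚ`).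
[cite: Moonen1999MTNotes, (1.7) and (1.8)] [cite: VoisinHodgeI2002, §7.3.2] -/
theorem nonempty_lieEquiv_hodgeLie_hodge_one_of_isIsogenous (h : IsIsogenous X X') :
    haveI := BettiUniverse.finite hX 1
    haveI := BettiUniverse.finite hX' 1
    letI : LieRing (Module.End ℚ (bettiCohomology X.X 1)) := LieRing.ofAssociativeRing
    letI : LieRing (Module.End ℚ (bettiCohomology X'.X 1)) := LieRing.ofAssociativeRing
    ∀ (𝔏 : LieSubalgebra ℚ (Module.End ℚ (bettiCohomology X.X 1)))
      (𝔏' : LieSubalgebra ℚ (Module.End ℚ (bettiCohomology X'.X 1))),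
      𝔏.toSubmodule = (BettiUniverse.hodge exists_isReal_hodgeModel_holds hX 1).hodgeLie →
      𝔏'.toSubmodule = (BettiUniverse.hodge exists_isReal_hodgeModel_holds hX' 1).hodgeLie →
      Nonempty (𝔏 ≃ₗ⁅ℚ⁆ 𝔏') := by
  intro 𝔏 𝔏' h𝔏 h𝔏'
  obtain ⟨g, hg⟩ := h
  obtain ⟨Φ, -⟩ := exists_lieEquiv_hodgeLie_hodge_one_of_isIsogeny hX hX' hg 𝔏' 𝔏 h𝔏' h𝔏
  exact ⟨Φ.symm⟩

/-- **Simplicity of `Lie Hg(H¹·)` is an isogeny invariant** (in the tree's idiom: every Lie subalgebra of `𝔤𝔩(H¹X)`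
with carrier `Lie Hg(H¹X)` is simple iff the same holds for `X'`). [cite: Moonen1999MTNotes, (1.7) and (1.8)]
[cite: MoonenZarhin1999LowDim, §1] -/
theorem isSimple_hodgeLie_hodge_one_iff_of_isIsogenous (h : IsIsogenous X X') :
    haveI := BettiUniverse.finite hX 1
    haveI := BettiUniverse.finite hX' 1
    letI : LieRing (Module.End ℚ (bettiCohomology X.X 1)) := LieRing.ofAssociativeRing
    letI : LieRing (Module.End ℚ (bettiCohomology X'.X 1)) := LieRing.ofAssociativeRing
    (∀ 𝔏 : LieSubalgebra ℚ (Module.End ℚ (bettiCohomology X.X 1)),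
        𝔏.toSubmodule = (BettiUniverse.hodge exists_isReal_hodgeModel_holds hX 1).hodgeLie →
          LieAlgebra.IsSimple ℚ 𝔏) ↔
      ∀ 𝔏' : LieSubalgebra ℚ (Module.End ℚ (bettiCohomology X'.X 1)),
        𝔏'.toSubmodule = (BettiUniverse.hodge exists_isReal_hodgeModel_holds hX' 1).hodgeLie →
          LieAlgebra.IsSimple ℚ 𝔏' := by
  haveI := BettiUniverse.finite hX 1
  haveI := BettiUniverse.finite hX' 1
  letI : LieRing (Module.End ℚ (bettiCohomology X.X 1)) := LieRing.ofAssociativeRing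
  letI : LieRing (Module.End ℚ (bettiCohomology X'.X 1)) := LieRing.ofAssociativeRing
  obtain ⟨𝔏₀, h𝔏₀⟩ := exists_lieSubalgebra_eq_hodgeLie (BettiUniverse.hodge exists_isReal_hodgeModel_holds hX 1)
  obtain ⟨𝔏₀', h𝔏₀'⟩ := exists_lieSubalgebra_eq_hodgeLie (BettiUniverse.hodge exists_isReal_hodgeModel_holds hX' 1)
  constructor
  · intro hs 𝔏' h𝔏'
    obtain ⟨Φ⟩ := nonempty_lieEquiv_hodgeLie_hodge_one_of_isIsogenous hX hX' h 𝔏₀ 𝔏' h𝔏₀ h𝔏'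
    haveI := hs 𝔏₀ h𝔏₀
    exact isSimple_of_lieEquiv' Φ.symm
  · intro hs 𝔏 h𝔏
    obtain ⟨Φ⟩ := nonempty_lieEquiv_hodgeLie_hodge_one_of_isIsogenous hX hX' h 𝔏 𝔏₀' h𝔏 h𝔏₀'
    haveI := hs 𝔏₀' h𝔏₀'
    exact isSimple_of_lieEquiv' Φ

end Isogeny

/-! ### §2 Powers `⨁_{Fin (a+1)} B` -/

section Const

variable {B : AbelianVariety ℂ} {k a m : ℕ} (hBsp : IsSmoothProjective k B.X)
  (hP : IsSmoothProjective m (⨁ fun _ : Fin (a + 1) => B).X)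

/-- **`Lie Hg(H¹B) ≅ Lie Hg(H¹(⨁_{Fin (a+1)} B))` as Lie algebras over `ℚ`** — the Lie-algebra form of «`Hg(Bⁿ)` is `Hg(B)`
acting diagonally»: the diagonal `𝔥(H) ≅ 𝔥(H^{⊕ι})` (`HodgeStructure.exists_lieEquiv_of_eq_hodgeLie_pi_const`) followed by
conjugation along Künneth `H¹(⨁ B) ≅ ⊕ H¹(B)` (`pi_hodge_one_eq_comapEquiv_biproduct`,
`HodgeStructure.exists_lieEquiv_of_eq_hodgeLie_comapEquiv`). [cite: MoonenZarhin1999LowDim, §1]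
[cite: Moonen1999MTNotes, (1.7) and (1.8)] [cite: VoisinHodgeI2002, §7.3.2] -/
theorem nonempty_lieEquiv_hodgeLie_hodge_one_biproduct_const :
    haveI := BettiUniverse.finite hBsp 1
    haveI := BettiUniverse.finite hP 1
    letI : LieRing (Module.End ℚ (bettiCohomology B.X 1)) := LieRing.ofAssociativeRing
    letI : LieRing (Module.End ℚ (bettiCohomology (⨁ fun _ : Fin (a + 1) => B).X 1)) := LieRing.ofAssociativeRing
    ∀ (𝔏 : LieSubalgebra ℚ (Module.End ℚ (bettiCohomology B.X 1)))
      (𝔏' : LieSubalgebra ℚ (Module.End ℚ (bettiCohomology (⨁ fun _ : Fin (a + 1) => B).X 1))),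
      𝔏.toSubmodule = (BettiUniverse.hodge exists_isReal_hodgeModel_holds hBsp 1).hodgeLie →
      𝔏'.toSubmodule = (BettiUniverse.hodge exists_isReal_hodgeModel_holds hP 1).hodgeLie →
      Nonempty (𝔏 ≃ₗ⁅ℚ⁆ 𝔏') := by
  haveI := BettiUniverse.finite hBsp 1
  haveI := BettiUniverse.finite hP 1
  letI : LieRing (Module.End ℚ (bettiCohomology B.X 1)) := LieRing.ofAssociativeRing
  letI : LieRing (Module.End ℚ (bettiCohomology (⨁ fun _ : Fin (a + 1) => B).X 1)) := LieRing.ofAssociativeRing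
  letI : LieRing (Module.End ℚ (Fin (a + 1) → bettiCohomology B.X 1)) := LieRing.ofAssociativeRing
  intro 𝔏 𝔏' h𝔏 h𝔏'
  -- the intermediate Lie algebra `𝔥(⊕ H¹(B))`
  obtain ⟨𝔏₁, h𝔏₁⟩ := exists_lieSubalgebra_eq_hodgeLie
    (pi fun _ : Fin (a + 1) => BettiUniverse.hodge exists_isReal_hodgeModel_holds hBsp 1)
  obtain ⟨Δ, -⟩ := exists_lieEquiv_of_eq_hodgeLie_pi_const (BettiUniverse.hodge exists_isReal_hodgeModel_holds hBsp 1)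
    𝔏 𝔏₁ h𝔏 h𝔏₁
  have hpi := pi_hodge_one_eq_comapEquiv_biproduct (A := fun _ : Fin (a + 1) => B) (fun _ => hBsp) hP
    exists_isReal_hodgeModel_holds hodgePQ_independent_of_hodgeModel_holds
  rw [hpi] at h𝔏₁
  obtain ⟨Φ, -⟩ := exists_lieEquiv_of_eq_hodgeLie_comapEquiv _ _ 𝔏₁ 𝔏' h𝔏₁ h𝔏'
  exact ⟨Δ.trans Φ⟩

/-- **`Lie Hg(H¹X) ≅ Lie Hg(H¹B)` as Lie algebras over `ℚ`, for every complex abelian variety `X` isogenous to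
`⨁_{Fin (a+1)} B`.** [cite: MoonenZarhin1999LowDim, §1] [cite: Moonen1999MTNotes, (1.7) and (1.8)] -/
theorem nonempty_lieEquiv_hodgeLie_hodge_one_of_isIsogenous_biproduct_const {X : AbelianVariety ℂ} {n' : ℕ}
    (hX : IsSmoothProjective n' X.X) (h : IsIsogenous X (⨁ fun _ : Fin (a + 1) => B)) :
    haveI := BettiUniverse.finite hX 1
    haveI := BettiUniverse.finite hBsp 1
    letI : LieRing (Module.End ℚ (bettiCohomology X.X 1)) := LieRing.ofAssociativeRing
    letI : LieRing (Module.End ℚ (bettiCohomology B.X 1)) := LieRing.ofAssociativeRing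
    ∀ (𝔏 : LieSubalgebra ℚ (Module.End ℚ (bettiCohomology X.X 1)))
      (𝔏' : LieSubalgebra ℚ (Module.End ℚ (bettiCohomology B.X 1))),
      𝔏.toSubmodule = (BettiUniverse.hodge exists_isReal_hodgeModel_holds hX 1).hodgeLie →
      𝔏'.toSubmodule = (BettiUniverse.hodge exists_isReal_hodgeModel_holds hBsp 1).hodgeLie →
      Nonempty (𝔏 ≃ₗ⁅ℚ⁆ 𝔏') := by
  haveI := BettiUniverse.finite hX 1
  haveI := BettiUniverse.finite hBsp 1
  have hP' : IsSmoothProjective (⨁ fun _ : Fin (a + 1) => B).dim (⨁ fun _ : Fin (a + 1) => B).X :=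
    AbelianVariety.isSmoothProjective_holds
  haveI := BettiUniverse.finite hP' 1
  letI : LieRing (Module.End ℚ (bettiCohomology X.X 1)) := LieRing.ofAssociativeRing
  letI : LieRing (Module.End ℚ (bettiCohomology B.X 1)) := LieRing.ofAssociativeRing
  letI : LieRing (Module.End ℚ (bettiCohomology (⨁ fun _ : Fin (a + 1) => B).X 1)) := LieRing.ofAssociativeRing
  intro 𝔏 𝔏' h𝔏 h𝔏'
  obtain ⟨𝔏₁, h𝔏₁⟩ := exists_lieSubalgebra_eq_hodgeLie (BettiUniverse.hodge exists_isReal_hodgeModel_holds hP' 1)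
  obtain ⟨Ψ⟩ := nonempty_lieEquiv_hodgeLie_hodge_one_of_isIsogenous hX hP' h 𝔏 𝔏₁ h𝔏 h𝔏₁
  obtain ⟨Φ⟩ := nonempty_lieEquiv_hodgeLie_hodge_one_biproduct_const hBsp hP' 𝔏' 𝔏₁ h𝔏' h𝔏₁
  exact ⟨Ψ.trans Φ.symm⟩

/-- **Simplicity of `Lie Hg(H¹·)` passes between a complex abelian variety `X ∼ ⨁_{Fin (a+1)} B` and `B`** (tree idiom:
every Lie subalgebra of `𝔤𝔩(H¹)` with carrier `Lie Hg` is simple). [cite: MoonenZarhin1999LowDim, §1]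
[cite: Moonen1999MTNotes, (1.7) and (1.8)] -/
theorem isSimple_hodgeLie_hodge_one_iff_of_isIsogenous_biproduct_const {X : AbelianVariety ℂ} {n' : ℕ}
    (hX : IsSmoothProjective n' X.X) (h : IsIsogenous X (⨁ fun _ : Fin (a + 1) => B)) :
    haveI := BettiUniverse.finite hX 1
    haveI := BettiUniverse.finite hBsp 1
    letI : LieRing (Module.End ℚ (bettiCohomology X.X 1)) := LieRing.ofAssociativeRing
    letI : LieRing (Module.End ℚ (bettiCohomology B.X 1)) := LieRing.ofAssociativeRing
    (∀ 𝔏 : LieSubalgebra ℚ (Module.End ℚ (bettiCohomology X.X 1)),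
        𝔏.toSubmodule = (BettiUniverse.hodge exists_isReal_hodgeModel_holds hX 1).hodgeLie →
          LieAlgebra.IsSimple ℚ 𝔏) ↔
      ∀ 𝔏' : LieSubalgebra ℚ (Module.End ℚ (bettiCohomology B.X 1)),
        𝔏'.toSubmodule = (BettiUniverse.hodge exists_isReal_hodgeModel_holds hBsp 1).hodgeLie →
          LieAlgebra.IsSimple ℚ 𝔏' := by
  haveI := BettiUniverse.finite hX 1
  haveI := BettiUniverse.finite hBsp 1
  letI : LieRing (Module.End ℚ (bettiCohomology X.X 1)) := LieRing.ofAssociativeRing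
  letI : LieRing (Module.End ℚ (bettiCohomology B.X 1)) := LieRing.ofAssociativeRing
  obtain ⟨𝔏₀, h𝔏₀⟩ := exists_lieSubalgebra_eq_hodgeLie (BettiUniverse.hodge exists_isReal_hodgeModel_holds hX 1)
  obtain ⟨𝔏₀', h𝔏₀'⟩ := exists_lieSubalgebra_eq_hodgeLie (BettiUniverse.hodge exists_isReal_hodgeModel_holds hBsp 1)
  constructor
  · intro hs 𝔏' h𝔏'
    obtain ⟨Φ⟩ := nonempty_lieEquiv_hodgeLie_hodge_one_of_isIsogenous_biproduct_const hBsp hX h 𝔏₀ 𝔏' h𝔏₀ h𝔏'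
    haveI := hs 𝔏₀ h𝔏₀
    exact isSimple_of_lieEquiv' Φ.symm
  · intro hs 𝔏 h𝔏
    obtain ⟨Φ⟩ := nonempty_lieEquiv_hodgeLie_hodge_one_of_isIsogenous_biproduct_const hBsp hX h 𝔏 𝔏₀' h𝔏 h𝔏₀'
    haveI := hs 𝔏₀' h𝔏₀'
    exact isSimple_of_lieEquiv' Φ

end Const

end AbelianVariety

end Literature.AlgebraicGeometry.Motives

end
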